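import Summits.AnomalousDissipation.AnomalousDissipation.Theorems.SolenoidalFractalHomogenisationLagrangianStepD1TailCrushOldState
import Summits.AnomalousDissipation.AnomalousDissipation.Theorems.SolenoidalFractalHomogenisationLagrangianStepD1TailCrushDecomp
import Summits.AnomalousDissipation.AnomalousDissipation.Theorems.SolenoidalFractalHomogenisationLagrangianStepD1TailBoundPair
import HarnessLib

/-!
# K1L_D `stub_D1_V0thg` (stmt-AnomalousDissipation-27980), R3′ lane, R3′-2 `D1TailCrushBound`, CASES C (DIAGONAL) AND D (FORWARD PARTNERS), CRUSHED:
# the fresh parts are `excQS` / `pairQS` exactly and the old memory is `C√ν`-small (helper; `--supports stmt-AnomalousDissipation-27980 --as helper`)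

Helper file of route `SolenoidalFractalHomogenisation` (one-generation hand `leafhand-ad-solenoidalfractalh-1` g1, road E-c).  The ε-twin of lane A4's
`D1Tail.tail_bound_caseC` (`…D1TailBoundDiag`): the same decomposition `meanFeedback_diag_apply` (fresh part = `excQS` exactly) and the same pickup bound of the
wrap term, with the state at `startⱼ` — the old memory, not forced since the end of slot `j` one period earlier — bounded by the CRUSHED OLD STATE
`D1Tail.crushed_old_state` (`C·√ν·SUP`) in place of `e^{−θmin}·SUP`, and the ε-scaled end game `tail_bound_of_decomp_eps`:
* **`tail_bound_caseC_eps`** — ν-free `C > 0`, `r₁ ∈ (0, 1/4]` with `|tailKernel ν S p q j j| ≤ C·√ν·gTail j j·(√PpSq_j(p)·√PpSq_j(q))` for `ν = r³`, `r ≤ r₁`,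
  every block-window background `S` (`NearIso(10/11, 11/10) ∩ OddSectorial(τ ≤ 1/20)`) and all `p, q`;
* **`tail_bound_caseD_eps`** — the ε-twin of `D1Tail.tail_bound_caseD` (`…D1TailBoundPair`) for the 13 forward partner pairs `(2l+1, 2l)`: fresh–fresh part
  `pairQS` exactly (`meanFeedback_pair_apply`), old state at `start_{2l}` = the crushed old state of slot `2l`.
* **`tail_bound_far_core_eps`** — the ε-twin of `D1Tail.tail_bound_far_core` (`…D1TailBoundFar`): for a pair without fresh part, a CRUSHED STATE BOUND
  along the pickup slot (hypothesis; supplied by `crushed_state_after` for the crushed class and by the mask argument for the ZERO class) gives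
  `|tailKernel| ≤ (ε·e^{θmin})·gTail·(…)`.
The per-pair bookkeeping of the crushed and ZERO classes (cases A/B/E) is NOT here.  No definitions, no sorry.  NOT a proof of `stub_D1_V0thg`, of K1L_D or of AD;
rung F-D1.A0 infrastructure.
-/

set_option linter.dupNamespace false

noncomputable section

namespace Summit.AnomalousDissipation.AnomalousDissipation.Theorems.SolenoidalFractalHomogenisation.LagrangianStep.D1Tail

open Summit.AnomalousDissipation.AnomalousDissipation.Theorems
open Summit.AnomalousDissipation.AnomalousDissipation.Theorems.SolenoidalFractalHomogenisation.LagrangianStep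
open Summit.AnomalousDissipation.AnomalousDissipation.Theorems.SolenoidalFractalHomogenisation.LagrangianStep.WCrossing
open Summit.AnomalousDissipation.AnomalousDissipation.Theorems.SolenoidalFractalHomogenisation.LagrangianStep.D1ResidueCert
open Summit.AnomalousDissipation.AnomalousDissipation.Theorems.SolenoidalFractalHomogenisation.LagrangianStep.D1TailCert
open Summit.AnomalousDissipation.AnomalousDissipation.Theorems.SolenoidalFractalHomogenisation.LagrangianStep.Sideband
open Summit.AnomalousDissipation.AnomalousDissipation.Theorems.SolenoidalFractalHomogenisation.LagrangianStep.CellChain (start_stretch_stretch)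
open Summit.AnomalousDissipation.AnomalousDissipation.Theorems.SolenoidalFractalHomogenisation.PermissibleCarrier
  (period_pos start_nonneg start_add_tau_le_period)
open Summit.AnomalousDissipation.AnomalousDissipation.Theorems.SolenoidalFractalHomogenisation.RealisedQuasiStaticCellLaw (start_add_tau_le_start)
open Literature.Analysis Literature.Analysis.FluidPDE Literature.Analysis.FunctionSpaces Literature.Analysis.FunctionSpaces.Torus
open Literature.Analysis.FluidPDE.Torus Literature.Analysis.FluidPDE.LatticeShear
open Set Real Complex MeasureTheory intervalIntegral
open scoped InnerProductSpace

set_option maxHeartbeats 400000 in -- pre-budgeted (ops-buildfix rule): the flat case C proof with the crushed state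
/-- **CASE C, CRUSHED** (diagonal): `|tailKernel ν S p q j j| ≤ C·√ν·gTail j j·(√PpSq_j(p)·√PpSq_j(q))` for `ν = r³ ≤ r₁³`.
[cite: ArmstrongVicol2025, §3] [cite: MajdaKramer1999, §2.2.1.3 (55)] [cite: BedrossianCotiZelati2017, §2] [cite: SandersVerhulstMurdock2007, Lemma 5.2.7] -/
theorem tail_bound_caseC_eps (j : Fin 26) :
    ∃ C r₁ : ℝ, 0 < C ∧ 0 < r₁ ∧ r₁ ≤ 1 / 4 ∧ ∀ {r : ℝ} (hr : 0 < r), r ≤ r₁ →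
      ∀ {S : T4}, Torus.NearIso S (10 / 11) (11 / 10) → ∀ τ ∈ Icc (0:ℝ) (1 / 20), OddSectorial S τ → ∀ p q : Fin 3 → ℝ,
      |tailKernel (r ^ 3) S p q j j| ≤ C * Real.sqrt (r ^ 3) * (gTail j j * (Real.sqrt (PpSq j p) * Real.sqrt (PpSq j q))) := by
  obtain ⟨C, r₁, hC, hr₁, hr₁4, hold⟩ := crushed_old_state j
  refine ⟨C * Real.exp θmin, r₁, by positivity, hr₁, hr₁4, ?_⟩
  intro r hr hr1 S hS τ hτ hodd p q
  have hν0 : 0 < r ^ 3 := pow_pos hr 3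
  have hν40 : r ^ 3 ≤ 1 / 40 := by
    have h := pow_le_pow_left₀ hr.le (hr1.trans hr₁4) 3
    linarith [show ((1:ℝ) / 4) ^ 3 ≤ 1 / 40 by norm_num]
  have hν : r ^ 3 ∈ Ioc (0:ℝ) (1 / 40) := ⟨hν0, hν40⟩
  set ε : ℝ := C * Real.sqrt (r ^ 3) with hε
  have hε0 : 0 ≤ ε := by positivity
  -- from here on: lane A4's case C with `ν = r³` and `ε` in place of `e^{−θmin}`
  set ν : ℝ := r ^ 3 with hνdef
  have hν1 : ν ≤ 1 := by linarith
  set W₁ := (cubatureWord.stretch MB MB_pos).stretch (1 / ν) (one_div_pos.mpr hν0) with hW₁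
  have h𝔸 : Torus.NearIso (ν • S) (ν * (10 / 11)) (ν * (11 / 10)) := hS.smul hν0.le
  have hlo : 0 < ν * (10 / 11) := by positivity
  set rν := min (1:ℝ) (4 * π ^ 2 * (ν * (10 / 11))) with hrν
  have hr0 : 0 ≤ rν := le_min zero_le_one (by positivity)
  have hNj := isPeriodicResponse_cubature hν0 hS j
  have hm := mem_box_cubature hν0 hν1 j
  have hm' := neg_mem_box_cubature hν0 hν1 j
  set N := response W₁ (ν • S) 1 (R0 ν) j with hNdef
  set pC : EuclideanSpace ℂ (Fin 3) := WithLp.toLp 2 fun i => ((p i : ℝ) : ℂ) with hpC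
  set qC : EuclideanSpace ℂ (Fin 3) := WithLp.toLp 2 fun i => ((q i : ℝ) : ℂ) with hqC
  set s := W₁.start j with hs
  set L := (W₁.phase j).τ with hL
  have hLpos : 0 < L := (W₁.phase j).τ_pos
  have hs0 : 0 ≤ s := start_nonneg W₁ j
  have hsP : s + L ≤ W₁.period := start_add_tau_le_period W₁ j
  set Bℝ := (blockGen (ν • S) 1 (W₁.phase j).m).restrictScalars ℝ with hB
  set xm := coordL (R0 ν) (-(W₁.phase j).m) (N s qC) with hxm
  set xp := coordL (R0 ν) (W₁.phase j).m (N s qC) with hxp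
  have hxm_le : ‖xm‖ ≤ ‖N s qC‖ := by rw [hxm]; exact norm_coordL_le _ _
  have hxp_le : ‖xp‖ ≤ ‖N s qC‖ := by rw [hxp]; exact norm_coordL_le _ _
  -- the wrap integrand
  obtain ⟨X, hX⟩ : ∃ X : ℝ → EuclideanSpace ℂ (Fin 3), X = fun t =>
      (2 * Real.pi * Complex.I * ((slotEnvelope W₁ j t : ℝ) : ℂ)) • (slotAmp W₁ j • NormedSpace.exp ((t - s) • Bℝ) xm + starRingEnd ℂ (slotAmp W₁ j) • NormedSpace.exp ((t - s) • Bℝ) xp) :=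
    ⟨_, rfl⟩
  have hEc : Continuous fun u : ℝ => NormedSpace.exp (u • Bℝ) := continuous_iff_continuousAt.2 fun u => (hasDerivAt_exp_smul_const Bℝ u).continuousAt
  have hXc : Continuous X := by
    rw [hX]
    refine (continuous_const.mul (Complex.continuous_ofReal.comp (continuous_slotEnvelope W₁ j))).smul ?_
    exact ((((hEc.comp (continuous_id.sub continuous_const)).clm_apply continuous_const).const_smul (slotAmp W₁ j)).add
      (((hEc.comp (continuous_id.sub continuous_const)).clm_apply continuous_const).const_smul (starRingEnd ℂ (slotAmp W₁ j))))
  -- the state at the slot start: not forced since the end of the slot one period earlier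
  set SUP : ℝ := 8 * π * ‖slotAmp W₁ j‖ / rν * ‖transversalProj (cubatureWord.phase j).m qC‖ with hSUP
  have hstate : ‖N s qC‖ ≤ ε * SUP := by
    have hsExt : N s qC = responseExt W₁ (ν • S) 1 (R0 ν) j s qC := by
      rw [hNdef, responseExt_of_mem_Ico W₁ (ν • S) 1 (R0 ν) j ⟨hs0, by linarith⟩]
    rw [hsExt]
    exact hold hr hr1 hS τ hτ hodd qC
  have hSUP0 : 0 ≤ SUP := by rw [hSUP]; positivity
  -- transversality of the old amplitudes and of their images under the own-slot semigroup
  have hsP' : s ∈ Icc 0 W₁.period := ⟨hs0, by linarith⟩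
  have hxmt : transversalProj (W₁.phase j).m xm = xm := transversalProj_coordL_response W₁ h𝔸 hlo one_pos (R := R0 ν) j hsP' qC _ _ (Or.inr rfl)
  have hxpt : transversalProj (W₁.phase j).m xp = xp := transversalProj_coordL_response W₁ h𝔸 hlo one_pos (R := R0 ν) j hsP' qC _ _ (Or.inl rfl)
  have hEt : ∀ (τ : ℝ) (x : EuclideanSpace ℂ (Fin 3)), transversalProj (W₁.phase j).m x = x →
      transversalProj (W₁.phase j).m (NormedSpace.exp (τ • Bℝ) x) = NormedSpace.exp (τ • Bℝ) x := by
    intro τ x hx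
    have h : transversalProj (W₁.phase j).m (NormedSpace.exp (τ • Bℝ) (transversalProj (W₁.phase j).m x)) = NormedSpace.exp (τ • Bℝ) (transversalProj (W₁.phase j).m x) :=
      transversalProj_exp_blockGen_transversalProj S ν 1 (W₁.phase j) τ x
    simpa only [hx] using h
  have hmne : (W₁.phase j).m ≠ 0 := (W₁.phase j).m_ne
  -- pointwise bound of the wrap pairing
  have hpt : ∀ t ∈ Set.uIoc s (s + L), ‖⟪pC, X t⟫_ℂ‖ ≤
      1 / (2 * ‖latticeVec (cubatureWord.phase j).m‖) * ‖transversalProj (cubatureWord.phase j).m pC‖ * (2 * (ε * SUP)) := by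
    intro t ht
    rw [Set.uIoc_of_le (by linarith)] at ht
    rw [hX]
    have hpick := norm_inner_pickup_le W₁ j t pC (hEt (t - s) xm hxmt) (hEt (t - s) xp hxpt)
    have hτ : 0 ≤ t - s := by linarith [ht.1]
    have h1 : Real.exp (-(rν * (t - s))) ≤ 1 := by
      rw [Real.exp_le_one_iff]
      have := mul_nonneg hr0 hτ
      linarith
    have hEm : ‖NormedSpace.exp ((t - s) • Bℝ) xm‖ ≤ ε * SUP :=
      (norm_exp_blockGen_le h𝔸 hlo.le 1 hmne xm hτ).trans ((mul_le_of_le_one_left (norm_nonneg _) h1).trans (hxm_le.trans hstate))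
    have hEp : ‖NormedSpace.exp ((t - s) • Bℝ) xp‖ ≤ ε * SUP :=
      (norm_exp_blockGen_le h𝔸 hlo.le 1 hmne xp hτ).trans ((mul_le_of_le_one_left (norm_nonneg _) h1).trans (hxp_le.trans hstate))
    have h0 : 0 ≤ 1 / (2 * ‖latticeVec (W₁.phase j).m‖) * ‖transversalProj (W₁.phase j).m pC‖ := by positivity
    calc ‖⟪pC, (2 * Real.pi * Complex.I * ((slotEnvelope W₁ j t : ℝ) : ℂ)) •
          (slotAmp W₁ j • NormedSpace.exp ((t - s) • Bℝ) xm + starRingEnd ℂ (slotAmp W₁ j) • NormedSpace.exp ((t - s) • Bℝ) xp)⟫_ℂ‖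
        ≤ 1 / (2 * ‖latticeVec (W₁.phase j).m‖) * ‖transversalProj (W₁.phase j).m pC‖ * (‖NormedSpace.exp ((t - s) • Bℝ) xm‖ + ‖NormedSpace.exp ((t - s) • Bℝ) xp‖) :=
          hpick
      _ ≤ 1 / (2 * ‖latticeVec (W₁.phase j).m‖) * ‖transversalProj (W₁.phase j).m pC‖ * (2 * (ε * SUP)) :=
          mul_le_mul_of_nonneg_left (by linarith) h0
      _ = _ := rfl
  -- the decomposition: the fresh part is `excQS` exactly
  have hdiag := meanFeedback_diag_apply cubatureWord MB_pos hν0 hS (by norm_num : (0:ℝ) < 10 / 11) j hm hm' qC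
  simp only at hdiag
  rw [← hW₁] at hdiag
  have hM : ν / (4 * π ^ 2) * (⟪pC, meanFeedback W₁ (ν • S) 1 (R0 ν) j j qC⟫_ℂ).re -
      (⟪pC, Matrix.toEuclideanCLM (n := Fin 3) (𝕜 := ℂ) ((freshMat S j j).map ((↑) : ℝ → ℂ)) qC⟫_ℂ).re =
      ν / (4 * π ^ 2) * (⟪pC, (1 / W₁.period) • ∫ t in s..s + L, X t⟫_ℂ).re := by
    rw [hdiag, freshMat_diag, cmat_smul, inner_add_right, Complex.add_re, mul_add, inner_smul_right, Complex.re_ofReal_mul,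
      _root_.smul_apply, inner_smul_right, Complex.re_ofReal_mul, hX]
    have hπ : π ≠ 0 := Real.pi_pos.ne'
    field_simp
    ring
  have hfin := tail_bound_of_decomp_eps hν S p q j j ε X (hXc.intervalIntegrable _ _) hM hpt
  calc |tailKernel ν S p q j j| ≤ ε * Real.exp θmin * gTail j j * (Real.sqrt (PpSq j p) * Real.sqrt (PpSq j q)) := hfin
    _ = C * Real.exp θmin * Real.sqrt (r ^ 3) * (gTail j j * (Real.sqrt (PpSq j p) * Real.sqrt (PpSq j q))) := by rw [hε]; ring



set_option maxHeartbeats 400000 in -- pre-budgeted (ops-buildfix rule): the flat case D proof with the crushed state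
/-- **CASE D, CRUSHED** (forward colinear pair `(2l+1, 2l)`): `|tailKernel ν S p q (2l+1) (2l)| ≤ C·√ν·gTail·(√PpSq·√PpSq)` for `ν = r³ ≤ r₁³`: the fresh–fresh
part is `pairQS` exactly and the old state at `start_{2l}` is the CRUSHED OLD STATE. [cite: ArmstrongVicol2025, §3] [cite: MajdaKramer1999, §2.2.1.3 (55)]
[cite: BedrossianCotiZelati2017, §2] [cite: SandersVerhulstMurdock2007, Lemma 5.2.7] -/
theorem tail_bound_caseD_eps (l : Fin 13) :
    ∃ C r₁ : ℝ, 0 < C ∧ 0 < r₁ ∧ r₁ ≤ 1 / 4 ∧ ∀ {r : ℝ} (hr : 0 < r), r ≤ r₁ →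
      ∀ {S : T4}, Torus.NearIso S (10 / 11) (11 / 10) → ∀ τ ∈ Icc (0:ℝ) (1 / 20), OddSectorial S τ → ∀ p q : Fin 3 → ℝ,
      |tailKernel (r ^ 3) S p q (sndSlot l) (fstSlot l)| ≤
        C * Real.sqrt (r ^ 3) * (gTail (sndSlot l) (fstSlot l) * (Real.sqrt (PpSq (sndSlot l) p) * Real.sqrt (PpSq (fstSlot l) q))) := by
  obtain ⟨C, r₁, hC, hr₁, hr₁4, hold⟩ := crushed_old_state (fstSlot l)
  refine ⟨C * Real.exp θmin, r₁, by positivity, hr₁, hr₁4, ?_⟩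
  intro r hr hr1 S hS τ hτw hodd p q
  have hν0 : 0 < r ^ 3 := pow_pos hr 3
  have hν40 : r ^ 3 ≤ 1 / 40 := by
    have h := pow_le_pow_left₀ hr.le (hr1.trans hr₁4) 3
    linarith [show ((1:ℝ) / 4) ^ 3 ≤ 1 / 40 by norm_num]
  have hν : r ^ 3 ∈ Ioc (0:ℝ) (1 / 40) := ⟨hν0, hν40⟩
  set ε : ℝ := C * Real.sqrt (r ^ 3) with hε
  have hε0 : 0 ≤ ε := by positivity
  set ν : ℝ := r ^ 3 with hνdef
  have hν1 : ν ≤ 1 := by linarith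
  set j := sndSlot l with hj
  set j' := fstSlot l with hj'
  obtain ⟨hmeq, hφ, hτ, hadj⟩ := cubature_pair_facts l
  rw [← hj, ← hj'] at hmeq hφ hτ hadj
  set W₁ := (cubatureWord.stretch MB MB_pos).stretch (1 / ν) (one_div_pos.mpr hν0) with hW₁
  have h𝔸 : Torus.NearIso (ν • S) (ν * (10 / 11)) (ν * (11 / 10)) := hS.smul hν0.le
  have hlo : 0 < ν * (10 / 11) := by positivity
  set rν := min (1:ℝ) (4 * π ^ 2 * (ν * (10 / 11))) with hrν
  have hr0 : 0 ≤ rν := le_min zero_le_one (by positivity)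
  have hNj' := isPeriodicResponse_cubature hν0 hS j'
  have hm : (cubatureWord.phase j).m ∈ box (R0 ν) := mem_box_cubature hν0 hν1 j
  have hm' : -(cubatureWord.phase j).m ∈ box (R0 ν) := neg_mem_box_cubature hν0 hν1 j
  set N := response W₁ (ν • S) 1 (R0 ν) j' with hNdef
  set pC : EuclideanSpace ℂ (Fin 3) := WithLp.toLp 2 fun i => ((p i : ℝ) : ℂ) with hpC
  set qC : EuclideanSpace ℂ (Fin 3) := WithLp.toLp 2 fun i => ((q i : ℝ) : ℂ) with hqC
  set s := W₁.start j with hs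
  set s' := W₁.start j' with hs'
  set L := (W₁.phase j).τ with hL
  set L' := (W₁.phase j').τ with hL'
  have hLpos : 0 < L := (W₁.phase j).τ_pos
  have hs'0 : 0 ≤ s' := start_nonneg W₁ j'
  have hs'P : s' + L' ≤ W₁.period := start_add_tau_le_period W₁ j'
  have hadj₁ : s = s' + L' := start_stretch_stretch_adj cubatureWord MB_pos hν0 hadj
  set Bℝ := (blockGen (ν • S) 1 (W₁.phase j).m).restrictScalars ℝ with hB
  set xm := coordL (R0 ν) (-(W₁.phase j).m) (N s' qC) with hxm
  set xp := coordL (R0 ν) (W₁.phase j).m (N s' qC) with hxp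
  have hxm_le : ‖xm‖ ≤ ‖N s' qC‖ := by rw [hxm]; exact norm_coordL_le _ _
  have hxp_le : ‖xp‖ ≤ ‖N s' qC‖ := by rw [hxp]; exact norm_coordL_le _ _
  obtain ⟨X, hX⟩ : ∃ X : ℝ → EuclideanSpace ℂ (Fin 3), X = fun t =>
      (2 * Real.pi * Complex.I * ((slotEnvelope W₁ j t : ℝ) : ℂ)) •
        (slotAmp W₁ j • NormedSpace.exp ((t - s') • Bℝ) xm + starRingEnd ℂ (slotAmp W₁ j) • NormedSpace.exp ((t - s') • Bℝ) xp) := ⟨_, rfl⟩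
  have hEc : Continuous fun u : ℝ => NormedSpace.exp (u • Bℝ) := continuous_iff_continuousAt.2 fun u => (hasDerivAt_exp_smul_const Bℝ u).continuousAt
  have hXc : Continuous X := by
    rw [hX]
    refine (continuous_const.mul (Complex.continuous_ofReal.comp (continuous_slotEnvelope W₁ j))).smul ?_
    exact ((((hEc.comp (continuous_id.sub continuous_const)).clm_apply continuous_const).const_smul (slotAmp W₁ j)).add
      (((hEc.comp (continuous_id.sub continuous_const)).clm_apply continuous_const).const_smul (starRingEnd ℂ (slotAmp W₁ j))))
  -- the state at the start of the source slot
  set SUP : ℝ := 8 * π * ‖slotAmp W₁ j'‖ / rν * ‖transversalProj (cubatureWord.phase j').m qC‖ with hSUP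
  have hs'I : s' ∈ Icc 0 W₁.period := ⟨hs'0, by linarith [(W₁.phase j').τ_pos]⟩
  have hstate : ‖N s' qC‖ ≤ ε * SUP := by
    have hsExt : N s' qC = responseExt W₁ (ν • S) 1 (R0 ν) j' s' qC := by
      rw [hNdef, responseExt_of_mem_Ico W₁ (ν • S) 1 (R0 ν) j' ⟨hs'0, by linarith [(W₁.phase j').τ_pos]⟩]
    rw [hsExt]
    exact hold hr hr1 hS τ hτw hodd qC
  have hSUP0 : 0 ≤ SUP := by rw [hSUP]; positivity
  -- transversality
  have hxmt : transversalProj (W₁.phase j).m xm = xm := transversalProj_coordL_response W₁ h𝔸 hlo one_pos (R := R0 ν) j' hs'I qC _ _ (Or.inr rfl)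
  have hxpt : transversalProj (W₁.phase j).m xp = xp := transversalProj_coordL_response W₁ h𝔸 hlo one_pos (R := R0 ν) j' hs'I qC _ _ (Or.inl rfl)
  have hEt : ∀ (τ : ℝ) (x : EuclideanSpace ℂ (Fin 3)), transversalProj (W₁.phase j).m x = x →
      transversalProj (W₁.phase j).m (NormedSpace.exp (τ • Bℝ) x) = NormedSpace.exp (τ • Bℝ) x := by
    intro τ x hx
    have h : transversalProj (W₁.phase j).m (NormedSpace.exp (τ • Bℝ) (transversalProj (W₁.phase j).m x)) =
        NormedSpace.exp (τ • Bℝ) (transversalProj (W₁.phase j).m x) :=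
      transversalProj_exp_blockGen_transversalProj S ν 1 (W₁.phase j) τ x
    simpa only [hx] using h
  have hmne : (W₁.phase j).m ≠ 0 := (W₁.phase j).m_ne
  -- pointwise bound of the wrap pairing
  have hpt : ∀ t ∈ Set.uIoc s (s + L), ‖⟪pC, X t⟫_ℂ‖ ≤
      1 / (2 * ‖latticeVec (cubatureWord.phase j).m‖) * ‖transversalProj (cubatureWord.phase j).m pC‖ * (2 * (ε * SUP)) := by
    intro t ht
    rw [Set.uIoc_of_le (by linarith)] at ht
    rw [hX]
    have hpick := norm_inner_pickup_le W₁ j t pC (hEt (t - s') xm hxmt) (hEt (t - s') xp hxpt)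
    have hτ : 0 ≤ t - s' := by linarith [ht.1, (W₁.phase j').τ_pos]
    have h1 : Real.exp (-(rν * (t - s'))) ≤ 1 := by
      rw [Real.exp_le_one_iff]
      have := mul_nonneg hr0 hτ
      linarith
    have hEm : ‖NormedSpace.exp ((t - s') • Bℝ) xm‖ ≤ ε * SUP :=
      (norm_exp_blockGen_le h𝔸 hlo.le 1 hmne xm hτ).trans ((mul_le_of_le_one_left (norm_nonneg _) h1).trans (hxm_le.trans hstate))
    have hEp : ‖NormedSpace.exp ((t - s') • Bℝ) xp‖ ≤ ε * SUP :=
      (norm_exp_blockGen_le h𝔸 hlo.le 1 hmne xp hτ).trans ((mul_le_of_le_one_left (norm_nonneg _) h1).trans (hxp_le.trans hstate))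
    have h0 : 0 ≤ 1 / (2 * ‖latticeVec (W₁.phase j).m‖) * ‖transversalProj (W₁.phase j).m pC‖ := by positivity
    calc ‖⟪pC, (2 * Real.pi * Complex.I * ((slotEnvelope W₁ j t : ℝ) : ℂ)) •
          (slotAmp W₁ j • NormedSpace.exp ((t - s') • Bℝ) xm + starRingEnd ℂ (slotAmp W₁ j) • NormedSpace.exp ((t - s') • Bℝ) xp)⟫_ℂ‖
        ≤ 1 / (2 * ‖latticeVec (W₁.phase j).m‖) * ‖transversalProj (W₁.phase j).m pC‖ *
            (‖NormedSpace.exp ((t - s') • Bℝ) xm‖ + ‖NormedSpace.exp ((t - s') • Bℝ) xp‖) := hpick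
      _ ≤ 1 / (2 * ‖latticeVec (W₁.phase j).m‖) * ‖transversalProj (W₁.phase j).m pC‖ * (2 * (ε * SUP)) :=
          mul_le_mul_of_nonneg_left (by linarith) h0
      _ = _ := rfl
  -- the decomposition: the fresh–fresh part is `pairQS` exactly
  have hpair := meanFeedback_pair_apply cubatureWord MB_pos hν0 hS (by norm_num : (0:ℝ) < 10 / 11) hmeq hφ hτ hadj hm hm' qC
  simp only at hpair
  rw [← hW₁] at hpair
  have hmh : mhat (cubatureWord.phase j) = mhat (cubatureWord.phase j') := mhat_pair l
  have hT : 4 * π ^ 2 * ‖latticeVec (cubatureWord.phase j).m‖ ^ 2 * MB * (cubatureWord.phase j).τ = slotT j' := by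
    unfold slotT; rw [← hmeq, ← hτ]
  have hsc : slotCoef cubatureWord j = slotCoef cubatureWord j' := slotCoef_pair l
  have hfresh' : freshMat S j j' = slotCoef cubatureWord j' • pairQ S j' := freshMat_pair S l
  -- the two fresh pairings coincide
  have hformR : (⟪pC, Matrix.toEuclideanCLM (n := Fin 3) (𝕜 := ℂ)
      ((pairResp cubatureWord.ramp (4 * π ^ 2 * ‖latticeVec (cubatureWord.phase j).m‖ ^ 2 * MB * (cubatureWord.phase j).τ)
        (regBlock S (mhat (cubatureWord.phase j))) * projPerp (mhat (cubatureWord.phase j))).map ((↑) : ℝ → ℂ)) qC⟫_ℂ).re =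
      ∑ i, ∑ l', p i * q l' * pairQ S j' i l' := by
    rw [hpC, hqC, ← re_inner_cmat_realVec, hT, hmh]
    unfold pairQ
    exact sum_sum_pairResp_projPerp cubatureWord.ramp (slotT j') S (sum_mhat_sq (cubatureWord.phase j')) p q
  have hformF : (⟪pC, Matrix.toEuclideanCLM (n := Fin 3) (𝕜 := ℂ) ((freshMat S j j').map ((↑) : ℝ → ℂ)) qC⟫_ℂ).re =
      slotCoef cubatureWord j' * ∑ i, ∑ l', p i * q l' * pairQ S j' i l' := by
    rw [hfresh', cmat_smul, _root_.smul_apply, inner_smul_right, Complex.re_ofReal_mul, hpC, hqC, ← re_inner_cmat_realVec]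
  have hMre : (⟪pC, meanFeedback W₁ (ν • S) 1 (R0 ν) j j' qC⟫_ℂ).re =
      4 * π ^ 2 / ν * slotCoef cubatureWord j * ∑ i, ∑ l', p i * q l' * pairQ S j' i l' + (⟪pC, (1 / W₁.period) • ∫ t in s..s + L, X t⟫_ℂ).re := by
    rw [hpair, inner_add_right, Complex.add_re, inner_smul_right, Complex.re_ofReal_mul, hformR, hX]
  have hM : ν / (4 * π ^ 2) * (⟪pC, meanFeedback W₁ (ν • S) 1 (R0 ν) j j' qC⟫_ℂ).re -
      (⟪pC, Matrix.toEuclideanCLM (n := Fin 3) (𝕜 := ℂ) ((freshMat S j j').map ((↑) : ℝ → ℂ)) qC⟫_ℂ).re =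
      ν / (4 * π ^ 2) * (⟪pC, (1 / W₁.period) • ∫ t in s..s + L, X t⟫_ℂ).re := by
    rw [hMre, hformF, hsc]
    have hπ : π ≠ 0 := Real.pi_pos.ne'
    have hν0' : ν ≠ 0 := hν0.ne'
    field_simp
    ring
  have hfin := tail_bound_of_decomp_eps hν S p q j j' ε X (hXc.intervalIntegrable _ _) hM hpt
  calc |tailKernel ν S p q j j'| ≤ ε * Real.exp θmin * gTail j j' * (Real.sqrt (PpSq j p) * Real.sqrt (PpSq j' q)) := hfin
    _ = C * Real.exp θmin * Real.sqrt (r ^ 3) * (gTail j j' * (Real.sqrt (PpSq j p) * Real.sqrt (PpSq j' q))) := by rw [hε]; ring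


set_option maxHeartbeats 400000 in -- pre-budgeted (ops-buildfix rule): the flat far-pair core with the crushed state
/-- **FAR-PAIR CORE BOUND, CRUSHED (ε-form).**  `ν ∈ (0, 1/40]`, `NearIso S (10/11) (11/10)`, `W₁ = (cubatureWord.stretch MB).stretch (1/ν)`.  If
`freshMat S j j' = 0` and the periodic response of the source slot `j'` obeys the CRUSHED STATE BOUND `‖N̄ t qC‖ ≤ ε·(8π‖α_{j'}‖/r_ν)·‖P_{j'} qC‖` along the
pickup slot `[startⱼ, startⱼ + τ¹ⱼ]` (from `crushed_state_after` for the crushed class, from the mask argument for the ZERO class), then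
`|tailKernel ν S p q j j'| ≤ (ε·e^{θmin})·gTail j j'·(√PpSq_j(p)·√PpSq_{j'}(q))`. [cite: ArmstrongVicol2025, §3] [cite: SandersVerhulstMurdock2007, Lemma 5.2.7] -/
theorem tail_bound_far_core_eps {ν : ℝ} (hν : ν ∈ Ioc (0:ℝ) (1 / 40)) {S : T4} (hS : Torus.NearIso S (10 / 11) (11 / 10)) (p q : Fin 3 → ℝ)
    {j j' : Fin 26} (hfresh : freshMat S j j' = 0) (ε : ℝ)
    (hcr : ∀ t ∈ Icc (((cubatureWord.stretch MB MB_pos).stretch (1 / ν) (one_div_pos.mpr hν.1)).start j)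
      (((cubatureWord.stretch MB MB_pos).stretch (1 / ν) (one_div_pos.mpr hν.1)).start j +
        (((cubatureWord.stretch MB MB_pos).stretch (1 / ν) (one_div_pos.mpr hν.1)).phase j).τ),
      ‖responseExt ((cubatureWord.stretch MB MB_pos).stretch (1 / ν) (one_div_pos.mpr hν.1)) (ν • S) 1 (R0 ν) j' t
          (WithLp.toLp 2 fun i => ((q i : ℝ) : ℂ))‖ ≤
        ε * (8 * π * ‖slotAmp ((cubatureWord.stretch MB MB_pos).stretch (1 / ν) (one_div_pos.mpr hν.1)) j'‖ /
          min (1:ℝ) (4 * π ^ 2 * (ν * (10 / 11))) * ‖transversalProj (cubatureWord.phase j').m (WithLp.toLp 2 fun i => ((q i : ℝ) : ℂ) : EuclideanSpace ℂ (Fin 3))‖)) :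
    |tailKernel ν S p q j j'| ≤ ε * Real.exp θmin * gTail j j' * (Real.sqrt (PpSq j p) * Real.sqrt (PpSq j' q)) := by
  obtain ⟨hν0, hν40⟩ := hν
  set W₁ := (cubatureWord.stretch MB MB_pos).stretch (1 / ν) (one_div_pos.mpr hν0) with hW₁
  have h𝔸 : Torus.NearIso (ν • S) (ν * (10 / 11)) (ν * (11 / 10)) := hS.smul hν0.le
  have hlo : 0 < ν * (10 / 11) := by positivity
  set r := min (1:ℝ) (4 * π ^ 2 * (ν * (10 / 11))) with hr
  have hNj' := isPeriodicResponse_cubature hν0 hS j'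
  set N := response W₁ (ν • S) 1 (R0 ν) j' with hNdef
  set Nb := responseExt W₁ (ν • S) 1 (R0 ν) j' with hNb
  set pC : EuclideanSpace ℂ (Fin 3) := WithLp.toLp 2 fun i => ((p i : ℝ) : ℂ) with hpC
  set qC : EuclideanSpace ℂ (Fin 3) := WithLp.toLp 2 fun i => ((q i : ℝ) : ℂ) with hqC
  set s := W₁.start j with hs
  set L := (W₁.phase j).τ with hL
  have hLpos : 0 < L := (W₁.phase j).τ_pos
  have hs0 : 0 ≤ s := start_nonneg W₁ j
  have hsP : s + L ≤ W₁.period := start_add_tau_le_period W₁ j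
  -- state / pickup constants
  set SUP : ℝ := 8 * π * ‖slotAmp W₁ j'‖ / r * ‖transversalProj (cubatureWord.phase j').m qC‖ with hSUP
  set C : ℝ := 1 / (2 * ‖latticeVec (cubatureWord.phase j).m‖) * ‖transversalProj (cubatureWord.phase j).m pC‖ * (2 * (ε * SUP))
    with hC
  have hSUP0 : 0 ≤ SUP := by rw [hSUP]; positivity
  -- pointwise state bound in the pickup slot: the crushed state (hypothesis)
  have hstate : ∀ t ∈ Icc s (s + L), ‖N t qC‖ ≤ ε * SUP := by
    intro t ht
    have htP : t ∈ Icc 0 W₁.period := ⟨hs0.trans ht.1, ht.2.trans hsP⟩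
    rw [hNdef, response_eq_responseExt W₁ (ν • S) 1 (R0 ν) j' hNj' htP]
    exact hcr t ht
  -- pointwise pairing bound
  have hpt : ∀ t ∈ Set.uIoc s (s + L), ‖⟪pC, feedback W₁ (R0 ν) j t (N t qC)⟫_ℂ‖ ≤ C := by
    intro t ht
    rw [Set.uIoc_of_le (by linarith)] at ht
    have ht' : t ∈ Icc s (s + L) := ⟨ht.1.le, ht.2⟩
    have htP : t ∈ Icc 0 W₁.period := ⟨hs0.trans ht'.1, ht'.2.trans hsP⟩
    have hfa := transversalProj_coordL_response W₁ h𝔸 hlo one_pos (R := R0 ν) j' htP qC (W₁.phase j).m (-(W₁.phase j).m) (Or.inr rfl)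
    have hfb := transversalProj_coordL_response W₁ h𝔸 hlo one_pos (R := R0 ν) j' htP qC (W₁.phase j).m ((W₁.phase j).m) (Or.inl rfl)
    have hpick := norm_inner_feedback_le W₁ (R0 ν) j t pC (y := N t qC) hfa hfb
    have hy1 : ‖coordL (R0 ν) (-(W₁.phase j).m) (N t qC)‖ ≤ ε * SUP := (norm_coordL_le _ _).trans (hstate t ht')
    have hy2 : ‖coordL (R0 ν) (W₁.phase j).m (N t qC)‖ ≤ ε * SUP := (norm_coordL_le _ _).trans (hstate t ht')
    have h0 : 0 ≤ 1 / (2 * ‖latticeVec (W₁.phase j).m‖) * ‖transversalProj (W₁.phase j).m pC‖ := by positivity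
    calc ‖⟪pC, feedback W₁ (R0 ν) j t (N t qC)⟫_ℂ‖
        ≤ 1 / (2 * ‖latticeVec (W₁.phase j).m‖) * ‖transversalProj (W₁.phase j).m pC‖ *
            (‖coordL (R0 ν) (-(W₁.phase j).m) (N t qC)‖ + ‖coordL (R0 ν) (W₁.phase j).m (N t qC)‖) := hpick
      _ ≤ 1 / (2 * ‖latticeVec (W₁.phase j).m‖) * ‖transversalProj (W₁.phase j).m pC‖ * (2 * (ε * SUP)) :=
            mul_le_mul_of_nonneg_left (by linarith) h0
      _ = C := by rw [hC]; rfl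
  -- the pairing with the period mean
  have hI := intervalIntegrable_feedback_comp W₁ (ν • S) 1 (R0 ν) j j' hNj' hs0 (by linarith) hsP
  have hX : ∫ t in s..s + L, (((feedback W₁ (R0 ν) j t).restrictScalars ℝ).comp (N t)) qC = ∫ t in s..s + L, feedback W₁ (R0 ν) j t (N t qC) :=
    intervalIntegral.integral_congr fun t _ => rfl
  have hXint : IntervalIntegrable (fun t => feedback W₁ (R0 ν) j t (N t qC)) volume s (s + L) := by
    have h := ((continuousOn_feedback_comp W₁ (ν • S) 1 (R0 ν) j j' hNj').mono (Icc_subset_Icc hs0 hsP)).clm_apply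
      (continuousOn_const (c := qC))
    exact (h.congr fun t _ => rfl).intervalIntegrable_of_Icc (by linarith)
  have hM : meanFeedback W₁ (ν • S) 1 (R0 ν) j j' qC = (1 / W₁.period) • ∫ t in s..s + L, feedback W₁ (R0 ν) j t (N t qC) := by
    rw [meanFeedback_eq_slot_integral W₁ (ν • S) 1 (R0 ν) j j' ⟨_, hNj'⟩, _root_.smul_apply, ContinuousLinearMap.intervalIntegral_apply hI qC, hX]
  -- assemble through the common end game
  have h0 : (0 : Matrix (Fin 3) (Fin 3) ℝ).map ((↑) : ℝ → ℂ) = 0 := by ext i j; simp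
  have hM' : ν / (4 * π ^ 2) * (⟪pC, meanFeedback W₁ (ν • S) 1 (R0 ν) j j' qC⟫_ℂ).re -
      (⟪pC, Matrix.toEuclideanCLM (n := Fin 3) (𝕜 := ℂ) ((freshMat S j j').map ((↑) : ℝ → ℂ)) qC⟫_ℂ).re =
      ν / (4 * π ^ 2) * (⟪pC, (1 / W₁.period) • ∫ t in s..s + L, feedback W₁ (R0 ν) j t (N t qC)⟫_ℂ).re := by
    rw [hM, hfresh, h0, map_zero, _root_.zero_apply, inner_zero_right, Complex.zero_re, sub_zero]
  have hpt' : ∀ t ∈ Set.uIoc s (s + L), ‖⟪pC, feedback W₁ (R0 ν) j t (N t qC)⟫_ℂ‖ ≤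
      1 / (2 * ‖latticeVec (cubatureWord.phase j).m‖) * ‖transversalProj (cubatureWord.phase j).m pC‖ *
        (2 * (ε * (8 * π * ‖slotAmp W₁ j'‖ / min (1:ℝ) (4 * π ^ 2 * (ν * (10 / 11))) * ‖transversalProj (cubatureWord.phase j').m qC‖))) := by
    intro t ht; have h := hpt t ht; rw [hC, hSUP, hr] at h; exact h
  exact tail_bound_of_decomp_eps ⟨hν0, hν40⟩ S p q j j' ε _ hXint hM' hpt'

/-! ## §2 No fresh part off the diagonal and the forward pairs -/


end Summit.AnomalousDissipation.AnomalousDissipation.Theorems.SolenoidalFractalHomogenisation.LagrangianStep.D1Tail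

end
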